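import Summits.CriticalPhenomena.CardyFormulaZ2.Theorems.CardyMagicRigidityMarkovCascadeDefs
import Summits.CriticalPhenomena.CardyFormulaZ2.Theorems.CardyMagicRigidityNestingRigiditySiteColourFlip
import Summits.CriticalPhenomena.CardyFormulaZ2.Theorems.CardyMagicRigidityNestingRigidityDomainEnsembleGluing
import Literature.Probability.RandomPlanarGeometry.LoopConfigurationsMetric
import Literature.Probability.Percolation.FullPlaneCNL
import HarnessLib

/-!
# Open b.c. on `𝕋` = type-swapped closed b.c., in law (crux `NestingRigidity`, line `markov-cascade-one-generation`)

Stub `cnLawEDist_openBC_typeSwap_T` of the checked skeleton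
`Cruxes/NestingRigidity/Lines/markov-cascade-one-generation.lean` (crux stmt-CriticalPhenomena-4835,
route `CardyMagicRigidity`): a lattice/metric input of the Markov-cascade bookkeeping, no crux content.

On `δ𝕋` the OPEN-boundary-condition domain ensemble of `U` — every site outside
`triMeshVertices U δ` declared open, `siteLoopConfig δ (ω ∪ (triMeshVertices U δ)ᶜ)` — has, IN LAW
under critical site percolation `PT = P_{1/2}`, exactly the TYPE-SWAPPED closed-b.c. ensemble
`⟨fun i ↦ (domLoopsT U δ ω).F (1 - i)⟩` (`domLoopsT U δ ω = siteLoopConfig δ (ω ∩ triMeshVertices U δ)`),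
stated as the vanishing of DKKMO's coupling distance `LoopConfig.cnLawEDist` (orientation of the
members is invisible to the unoriented loop distance `UnbasedLoop.udist`).

Proof.  Couple `ω' := ωᶜ` with `ω` (`Q := PT.map fun ω ↦ (ωᶜ, ω)`): the first marginal is
`PT.map compl = PT` (`PT_map_compl`, colour symmetry at `p = 1/2`), the second is `PT`.  On the image,
`ωᶜ ∪ Vᶜ = (ω ∩ V)ᶜ` and the colour flip acts on the typed configuration as reversal of every member
together with the type swap (`mem_siteLoopConfig_compl_iff`), so every loop of either configuration has
its reversal as a same-type partner in the other one: `d_CN ≤ ε` holds surely for every `ε ≥ 0`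
(`LoopConfig.IsClose.of_forall_mem_or_reverse_mem`).  The exceptional event is measurable (both
configurations are countably generated, `LoopConfig.measurableSet_isClose_of_gen`) with empty preimage,
hence `Q`-null; `LoopConfig.cnLawEDist_le_iff_forall_lt` at `r = 0` concludes.
-/

noncomputable section

open MeasureTheory Set Filter
open scoped Topology BigOperators ENNReal Real

namespace Summit.CriticalPhenomena.CardyFormulaZ2.Cruxes.NestingRigidity.MarkovCascadeOneGeneration

open Literature.Probability.RandomPlanarGeometry Literature.Probability.Percolation
  Literature.Probability.LatticeModels
open Summit.CriticalPhenomena.CardyFormulaZ2.Theses.CardyMagicRigidity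

/-! ### Sure closeness of the open-b.c. ensemble of `ωᶜ` and the type-swapped closed-b.c. ensemble of `ω` -/

/-- **Colour flip, domain version.** A loop is a type-`i` member of the open-b.c. ensemble of `ωᶜ` in
`U` iff its reversal is a type-`(1 - i)` member of the closed-b.c. ensemble `domLoopsT U δ ω`:
`ωᶜ ∪ Vᶜ = (ω ∩ V)ᶜ` and `mem_siteLoopConfig_compl_iff`. [folklore] -/
theorem mem_siteLoopConfig_compl_union_compl_iff (U : Set ℂ) (δ : ℝ) (ω : SiteConfig (Site 2))
    (i : Fin 2) (u : UnbasedLoop ℂ) :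
    u ∈ (siteLoopConfig δ (ωᶜ ∪ (triMeshVertices U δ)ᶜ)).F i ↔
      u.reverse ∈ (domLoopsT U δ ω).F (1 - i) := by
  rw [← compl_inter]
  exact mem_siteLoopConfig_compl_iff δ (ω ∩ triMeshVertices U δ) i u

/-- **Sure closeness on the graph of the colour flip**: for every `ε ≥ 0` the open-b.c. ensemble of
`ωᶜ` and the type-swapped closed-b.c. ensemble of `ω` satisfy `d_CN ≤ ε` — every member of either one
has its reversal as a same-type member of the other, and `udist` does not see orientations
(`LoopConfig.IsClose.of_forall_mem_or_reverse_mem`, `LoopConfig.isClose_self`). [folklore] -/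
theorem isClose_openBC_compl_typeSwap_T {ε : ℝ} (hε : 0 ≤ ε) (U : Set ℂ) (δ : ℝ)
    (ω : SiteConfig (Site 2)) :
    LoopConfig.IsClose ε (siteLoopConfig δ (ωᶜ ∪ (triMeshVertices U δ)ᶜ))
      (⟨fun i ↦ (domLoopsT U δ ω).F (1 - i)⟩ : LoopConfig ℂ) := by
  refine (LoopConfig.isClose_self hε (⟨fun i ↦ (domLoopsT U δ ω).F (1 - i)⟩ : LoopConfig ℂ))
    |>.of_forall_mem_or_reverse_mem (fun i u hu ↦ Or.inr ?_) (fun i u hu ↦ Or.inr ?_)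
  · exact (mem_siteLoopConfig_compl_union_compl_iff U δ ω i u).1 hu
  · rw [mem_siteLoopConfig_compl_union_compl_iff, UnbasedLoop.reverse_reverse]
    exact hu

/-! ### Measurability of the exceptional event -/

/-- Declaring a fixed set of sites open, `ω ↦ ω ∪ M`, is a measurable self-map of the configuration
space. [folklore] -/
theorem measurable_union_const_siteConfig {X : Type*} (M : Set X) : Measurable fun ω : Set X ↦ ω ∪ M :=
  measurable_set_iff.2 fun a ↦ (measurable_set_mem a).or measurable_const

/-- **The open-b.c. ensemble is countably generated**: by the loops of the closed honeycomb walks,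
switched on by the pull-backs of the generating events of `siteLoopConfig δ` along the
boundary-condition map `ω ↦ ω ∪ (triMeshVertices U δ)ᶜ` (`gen_siteLoopConfig`, `LoopConfig.gen_comp`).
[folklore] -/
theorem gen_openBC_T (U : Set ℂ) (δ : ℝ) :
    ∀ (ω : SiteConfig (Site 2)) (i : Fin 2) (u : UnbasedLoop ℂ),
      u ∈ (siteLoopConfig δ (ω ∪ (triMeshVertices U δ)ᶜ)).F i ↔ ∃ k : Σ v : HexVertex, hexGraph.Walk v v,
        ω ∈ (fun ω : SiteConfig (Site 2) ↦ ω ∪ (triMeshVertices U δ)ᶜ) ⁻¹'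
          {ω : SiteConfig (Site 2) | IsSiteInterfaceLoop ω k.2 ∧
            (i = 1 ↔ 0 < shoelace (k.2.support.map hexCenter))} ∧
        UnbasedLoop.mk (BasedLoop.mk (siteLoopCurve δ k.2) (isLoop_siteLoopCurve δ k.2)) = u :=
  LoopConfig.gen_comp (gen_siteLoopConfig δ) fun ω : SiteConfig (Site 2) ↦ ω ∪ (triMeshVertices U δ)ᶜ

/-- The generating events of `gen_openBC_T` are measurable. [folklore] -/
theorem measurableSet_gen_openBC_T (U : Set ℂ) (δ : ℝ) (i : Fin 2)
    (k : Σ v : HexVertex, hexGraph.Walk v v) :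
    MeasurableSet ((fun ω : SiteConfig (Site 2) ↦ ω ∪ (triMeshVertices U δ)ᶜ) ⁻¹'
      {ω : SiteConfig (Site 2) | IsSiteInterfaceLoop ω k.2 ∧
        (i = 1 ↔ 0 < shoelace (k.2.support.map hexCenter))}) :=
  measurable_union_const_siteConfig (triMeshVertices U δ)ᶜ (measurableSet_gen_siteLoopConfig i k)

/-- **The type-swapped closed-b.c. ensemble is countably generated**: same loops and events as
`domLoopsT U δ` (`gen_domLoopsT`), with the type index relabelled `i ↦ 1 - i`. [folklore] -/
theorem gen_typeSwap_domLoopsT (U : Set ℂ) (δ : ℝ) :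
    ∀ (ω : SiteConfig (Site 2)) (i : Fin 2) (u : UnbasedLoop ℂ),
      u ∈ ((⟨fun i ↦ (domLoopsT U δ ω).F (1 - i)⟩ : LoopConfig ℂ)).F i ↔
        ∃ k : Σ v : HexVertex, hexGraph.Walk v v,
          ω ∈ (fun ω : SiteConfig (Site 2) ↦ ω ∩ triMeshVertices U δ) ⁻¹'
            {ω : SiteConfig (Site 2) | IsSiteInterfaceLoop ω k.2 ∧
              (1 - i = 1 ↔ 0 < shoelace (k.2.support.map hexCenter))} ∧
          UnbasedLoop.mk (BasedLoop.mk (siteLoopCurve δ k.2) (isLoop_siteLoopCurve δ k.2)) = u :=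
  fun ω i u ↦ gen_domLoopsT U δ ω (1 - i) u

/-- **The exceptional event is measurable**:
`{(ω', ω) | d_CN(open-b.c. ensemble of ω', type-swapped closed-b.c. ensemble of ω) ≤ ε}` is a
measurable subset of `SiteConfig (Site 2) × SiteConfig (Site 2)`
(`LoopConfig.measurableSet_isClose_of_gen`). [folklore] -/
theorem measurableSet_isClose_openBC_typeSwap_T (U : Set ℂ) (δ ε : ℝ) :
    MeasurableSet {p : SiteConfig (Site 2) × SiteConfig (Site 2) |
      LoopConfig.IsClose ε (siteLoopConfig δ (p.1 ∪ (triMeshVertices U δ)ᶜ))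
        (⟨fun i ↦ (domLoopsT U δ p.2).F (1 - i)⟩ : LoopConfig ℂ)} := by
  haveI := countable_sigma_hexLoop
  exact LoopConfig.measurableSet_isClose_of_gen
    (X := fun ω : SiteConfig (Site 2) ↦ siteLoopConfig δ (ω ∪ (triMeshVertices U δ)ᶜ))
    (X' := fun ω : SiteConfig (Site 2) ↦ (⟨fun i ↦ (domLoopsT U δ ω).F (1 - i)⟩ : LoopConfig ℂ))
    (S' := fun i k ↦ (fun ω : SiteConfig (Site 2) ↦ ω ∩ triMeshVertices U δ) ⁻¹'
      {ω : SiteConfig (Site 2) | IsSiteInterfaceLoop ω k.2 ∧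
        (1 - i = 1 ↔ 0 < shoelace (k.2.support.map hexCenter))})
    (measurableSet_gen_openBC_T U δ) (gen_openBC_T U δ)
    (fun i k ↦ measurableSet_gen_domLoopsT U δ (1 - i) k) (gen_typeSwap_domLoopsT U δ) ε

/-! ### The stub -/

/-- **Open b.c. on `𝕋` = type-swapped closed b.c., in law.** Under critical site percolation the
open-b.c. domain ensemble `siteLoopConfig δ (ω ∪ (triMeshVertices U δ)ᶜ)` and the type-swapped
closed-b.c. ensemble `⟨fun i ↦ (domLoopsT U δ ω).F (1 - i)⟩` are at coupling distance `d_CN = 0`: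
couple `ωᶜ` with `ω` (`PT.map compl = PT`, `PT_map_compl`); on this coupling `d_CN ≤ ε` holds surely
for every `ε > 0` (`isClose_openBC_compl_typeSwap_T`), the exceptional event is measurable
(`measurableSet_isClose_openBC_typeSwap_T`) with empty preimage, and
`LoopConfig.cnLawEDist_le_iff_forall_lt` at `r = 0` concludes. [folklore] -/
theorem cnLawEDist_openBC_typeSwap_T : ∀ (U : Set ℂ) (δ : ℝ), LoopConfig.cnLawEDist PT (fun ω ↦ siteLoopConfig δ (ω ∪ (triMeshVertices U δ)ᶜ)) PT (fun ω ↦ (⟨fun i ↦ (domLoopsT U δ ω).F (1 - i)⟩ : LoopConfig ℂ)) = 0 := by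
  intro U δ
  have hg : Measurable fun ω : SiteConfig (Site 2) ↦ (ωᶜ, ω) := measurable_compl.prodMk measurable_id
  refine le_antisymm ?_ bot_le
  rw [← ENNReal.ofReal_zero]
  refine (LoopConfig.cnLawEDist_le_iff_forall_lt le_rfl).2 fun ε hε ↦
    ⟨PT.map fun ω : SiteConfig (Site 2) ↦ (ωᶜ, ω), ?_, ?_, ?_⟩
  · rw [Measure.map_map measurable_fst hg]
    exact PT_map_compl
  · rw [Measure.map_map measurable_snd hg]
    exact Measure.map_id
  · rw [← compl_setOf, Measure.map_apply hg (measurableSet_isClose_openBC_typeSwap_T U δ ε).compl]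
    have he : (fun ω : SiteConfig (Site 2) ↦ (ωᶜ, ω)) ⁻¹'
        {p : SiteConfig (Site 2) × SiteConfig (Site 2) |
          LoopConfig.IsClose ε (siteLoopConfig δ (p.1 ∪ (triMeshVertices U δ)ᶜ))
            (⟨fun i ↦ (domLoopsT U δ p.2).F (1 - i)⟩ : LoopConfig ℂ)}ᶜ = ∅ :=
      eq_empty_of_forall_notMem fun ω h ↦ h (isClose_openBC_compl_typeSwap_T hε.le U δ ω)
    rw [he, measure_empty]
    exact ENNReal.ofReal_pos.2 hε

end Summit.CriticalPhenomena.CardyFormulaZ2.Cruxes.NestingRigidity.MarkovCascadeOneGeneration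

end
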